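import Literature.MathematicalPhysics.QuantumFieldTheory.Balaban1983to89.Beta.PrefixAbsorption
import Summits.QuantumFields.BalabanUV.Gaps.CapTailFloors

/-!
# Gaps / CapFloorNotNecessary — SHARPNESS of the necessary conditions of `Gaps/CapSignsNecessary`: a floor of the one-loop coefficients is NOT
# necessary for [I] Theorem 2 AS PRINTED, and at the boundary `β⁰_{k+1} = 0` the remainder's sign decides (cell pub-balaban-gaps, seat g1-p3 gen 3,
# CAP+tail «split ∕ weakening» charge)

HONEST FRAMING (cell rule, page 1 of everything): bookkeeping over the β sub-cell's hypothesis carriers (`FlowStep.HBeta`, `B12Beta.OneLoopSplit`,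
`B12.Construction`, `FlowStepRuns.modelOf`) with two EXPLICIT toy families; NOTHING of Bałaban's is asserted beyond print; [Balaban1987RG1] Thm 2 is
UNPROVED IN PRINT; the families below are NOT Bałaban's β-functions (1.22) — they are kernel witnesses about which HYPOTHESIS SHAPES do or do not
imply the printed statement; 0 binders discharged; NOT `BetaPertH`, NOT the continuum limit, NOT Clay.
HONEST DEPENDENCY (b2b cell, verbatim): «continuum YM on T⁴ ⇐ BetaPertH ∧ nine spine estimates (0/9 proved); BetaPertH ⇐ (D1) ∧ (D4) ∧ CAP+tail;
G-an2-4 gates asym, D1 and NE2/3/4.»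

CONTEXT.  `Gaps/CapSignsNecessary` (same seat) proves the NECESSARY side of rows CAP ∕ tail for the (0.31) row: (N1) `0 ≤ β⁰_{k+1}` for every `k`
(remainder small at the zero history, scale-wise) and (N2) positive long-window means `c·n − A ≤ Σ_{j∈[k,k+n)} β⁰_{j+1}` on the every-slope
road (hence on the (AF-1) road); the
companions `CapTailSigns` ∕ `CapSignsConstRoad` ∕ `CapTailFloors` prove the SUFFICIENT side (strict signs below `k₀` + an eventual floor, i.e. a
uniform positive FLOOR of `β⁰`).  This file closes the bracket from the other side with kernel witnesses:

§1 `thm2Printed_of_windowFloor` — (0.31) FROM REALISED WINDOW FLOORS, the exact sufficiency shape the printed quantifier order allows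
   (`∃ β, β′` AFTER `g`, BEFORE `K`): `0 ≤ β_{k+1} ≤ β′` + (C) on the boxes and, for each box and renormalised `g`, ONE `c ∈ ]0,β′]` below every
   realised window sum `Σ_{j∈[k,K)} β_{j+1}(g_0,…,g_j)` ⟹ `B12.Thm2Printed C L` (`L > 1`; runs from `FlowStepRuns.regimeRun_exists`, `b = 0`).
§2 THE ALTERNATING SPLIT `altSplit` (`β⁰_{k+1} = 0` at even `k`, `2` at odd `k`; remainder `+g_k` at even `k`; (AF-1) with `C_r = 1`, `EverySlope`):
   `thm2Printed_alt` — EVERY forward-generated construction satisfies Theorem 2 as printed for every `L > 1` (window floor `c = g/2`: a window of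
   length `≥ 2` contains an odd scale; the length-one window at an even scale is the realised `g_k ≥ g/2` by `1/g_k² = 1/g² + g_k ≤ 2/g²`), although
   `β⁰_1 = 0` (`altSplit_beta0_zero`) and there is NO eventual floor (`not_eventualFloor_alt`).  Census form `floor_not_necessary`.  So the strict
   sign list and the tail's (eventual) floor ∕ rate ∕ limit are SUFFICIENT, NOT NECESSARY for (0.31); what is necessary is (N1) + (N2).
§3 THE BOUNDARY `negSplit` (`β⁰_1 = 0`, remainder `−g_0`; `β_{k+1} ≡ 1` for `k ≥ 1`): meets (N1), (N2), (AF-1) ∕ `EverySlope`, yet NO forward-generated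
   construction (halting outside, curried) satisfies Theorem 2 as printed for any `L > 1` (`not_thm2Printed_neg`, via the tree's
   `Beta.PrefixAbsorption.first_beta_pos_of_thm2Printed`).  Census form `boundary_decided_by_remainder`: same `β⁰_1 = 0`, opposite verdicts — a
   certified `β⁰_{k+1} = 0` EXACTLY would leave (0.31) to the remainder; any certified `β⁰_{k+1} ≠ 0` is decided by its sign ((N1) ∕ the companions).
§4 THE FACE FAMILY `faceSplit` (`β ≡ 1` off the face `g_k = 0`, `−1` on it; so `β⁰ ≡ −1`, remainder `2` off the face — a FIXED constant, NOT
   small near zero): `thm2Printed_face` — Theorem 2 as printed HOLDS although EVERY `β⁰_{k+1} < 0`.  Census form `nearZero_control_needed`: the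
   near-zero control of the remainder in (N1)∕(N2) is LOAD-BEARING; with the bare (D4) shape `RemainderConst S γ r` (one fixed `r`) a certified
   negative coefficient would NOT refute (0.31) — the printed split pins `β⁰_{k+1} = β_{k+1}|_{g_k=0}`, which sees (0.31) only through continuity
   at the face ([I] p. 264 «defined on [0, γ]»).
All [folklore] real-sequence bookkeeping; 0 sorry; the six `def`s are the three toy families and their splits (hypothesis-shape witnesses, like the
tree's `FlowStepRuns.betaAlt`, `Beta.Assembly.Witness.splitOne`, `CapSignsConstRoad.Witness.splitW`); nothing about Bałaban's objects.
-/

namespace Summit.QuantumFields.BalabanUV.Gaps.CapFloorNotNecessary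

open Literature.MathematicalPhysics.QuantumFieldTheory.Balaban1983to89
open Literature.MathematicalPhysics.QuantumFieldTheory.Balaban1983to89.FlowStep
open Literature.MathematicalPhysics.QuantumFieldTheory.Balaban1983to89.FlowStepRuns
open Literature.MathematicalPhysics.QuantumFieldTheory.Balaban1983to89.DagBinding
open Literature.MathematicalPhysics.QuantumFieldTheory.Balaban1983to89.Beta.PrefixAbsorption (first_beta_pos_of_thm2Printed)
open Literature.MathematicalPhysics.QuantumFieldTheory.Balaban1983to89.Beta.RemainderChain (RemainderConst)
open Summit.QuantumFields.BalabanUV.Gaps.CapSignsConstRoad (EverySlope everySlope_of_af1)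

noncomputable section

variable {β : HBeta}

/-! ## §1 (0.31) from realised window floors — the sufficiency shape the printed quantifier order allows -/

/-- **(0.31) FROM REALISED WINDOW FLOORS** — the exact sufficiency shape the printed quantifier order allows (`∃ β, β′` AFTER `g`, BEFORE `K`).  For a
forward-generated construction whose β-family is continuous with `0 ≤ β_{k+1} ≤ β′` on the boxes `]0,γ₀]^{k+1}`, suppose that for every box
`γ ≤ γ₀` and renormalised `g ≤ γ` some `c ∈ ]0, β′]` bounds from below EVERY realised window sum: `c·(K−k) ≤ Σ_{j∈[k,K)} β_{j+1}(g_0,…,g_j)` for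
every solution of the history recursion in `]0,γ]` ending at `g_K = g` and every `k < K`.  Then `B12.Thm2Printed C L` for every `L > 1`
(`β = c/log L`, `β′/log L`; runs from `FlowStepRuns.regimeRun_exists` with `b = 0`). [cite: Balaban1987RG1, Thm 2 (0.31) p.259] -/
theorem thm2Printed_of_windowFloor {C : B12.Construction} (hgen : ForwardGenerated C β) {γ₀ β' : ℝ} (hγ₀ : 0 < γ₀)
    (hβ' : 0 ≤ β') (hcont : BetaContH γ₀ β) (hlo : BetaLowerH 0 γ₀ β) (hup : BetaUpperH β' γ₀ β)
    (hwin : ∀ γ : ℝ, 0 < γ → γ ≤ γ₀ → ∀ g : ℝ, 0 < g → g ≤ γ → ∃ c : ℝ, 0 < c ∧ c ≤ β' ∧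
      ∀ (gs : ℕ → ℝ) (K : ℕ), Step.InInterval γ K gs → gs K = g → RGEqH K β gs →
        ∀ k, k < K → c * ((K : ℝ) - k) ≤ ∑ j ∈ Finset.Ico k K, β j (prefixOf gs j))
    {L : ℝ} (hL : 1 < L) : B12.Thm2Printed C L := by
  intro m
  refine ⟨γ₀, hγ₀, fun γ hγ hγle => ⟨γ, hγ, fun g hg hgle => ?_⟩⟩
  obtain ⟨c, hc, hcβ', hw⟩ := hwin γ hγ hγle g hg hgle
  have hlog : 0 < Real.log L := Real.log_pos hL
  refine ⟨c / Real.log L, β' / Real.log L, by positivity, div_le_div_of_nonneg_right hcβ' hlog.le, fun K => ?_⟩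
  obtain ⟨g0, hI, hend, hrg, hD, -⟩ := regimeRun_exists hgen le_rfl hβ' hcont hlo hup m hγ hγle hg hgle K
  refine ⟨g0, hI, hend, fun k hk => ⟨?_, ?_⟩⟩
  · rcases Nat.lt_or_ge k K with hlt | hge
    · have h1 := hw _ K hI hend hrg k hlt
      have ht := inv_sq_telescopeH hrg hk le_rfl
      rw [hend] at ht
      have e : c / Real.log L * (((K : ℝ) - k) * Real.log L) = c * ((K : ℝ) - k) := by field_simp
      rw [e]
      linarith
    · have hkK : k = K := le_antisymm hk hge
      subst hkK
      simp [hend]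
  · have h2 := (hD k hk).2
    have e : β' / Real.log L * (((K : ℝ) - k) * Real.log L) = β' * ((K : ℝ) - k) := by field_simp
    rw [e]
    exact h2

/-! ## §2 The ALTERNATING split: `β⁰_{k+1} = 0` at even `k`, `2` at odd `k`; remainder `+g_k` at even `k` — Theorem 2 as printed HOLDS -/

/-- The alternating history family: `β_{k+1}(g_0,…,g_k) = g_k` for even `k`, `= 2` for odd `k`. [folklore] -/
def altBeta : HBeta := fun k p => if k % 2 = 0 then p (Fin.last k) else 2

/-- Its printed one-loop split: `β⁰_{k+1} = 0` (even `k`) ∕ `2` (odd `k`); `β¹_{k+1}(p) = p_k` (even `k`) ∕ `0` (odd `k`) — vanishing at `g_k = 0`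
as [I] (2.13) demands. [folklore] -/
def altSplit : B12Beta.OneLoopSplit altBeta where
  β0 k := if k % 2 = 0 then 0 else 2
  β1 k p := if k % 2 = 0 then p (Fin.last k) else 0
  split k p := by unfold altBeta; split_ifs <;> simp
  vanish k p hp := by split_ifs <;> simp [hp]

/-- `β⁰_{k+1} = 0` at even `k`. [folklore] -/
theorem altSplit_beta0_of_even {k : ℕ} (hk : k % 2 = 0) : altSplit.β0 k = 0 := by simp [altSplit, hk]

/-- `β⁰_{k+1} = 2` at odd `k`. [folklore] -/
theorem altSplit_beta0_of_odd {k : ℕ} (hk : k % 2 = 1) : altSplit.β0 k = 2 := by simp [altSplit, hk]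

/-- The FIRST one-loop coefficient of the alternating split VANISHES: `β⁰_1 = 0`. [folklore] -/
theorem altSplit_beta0_zero : altSplit.β0 0 = 0 := altSplit_beta0_of_even rfl

/-- (N1) holds (non-strictly) for the alternating split. [folklore] -/
theorem altSplit_beta0_nonneg (k : ℕ) : 0 ≤ altSplit.β0 k := by
  rcases Nat.mod_two_eq_zero_or_one k with h | h
  · rw [altSplit_beta0_of_even h]
  · rw [altSplit_beta0_of_odd h]; norm_num

/-- The alternating split has NO eventual positive floor (`β⁰_{k+1} = 0` at every even `k`), a fortiori no uniform floor and no positive limit.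
[folklore] -/
theorem not_eventualFloor_alt : ¬ ∃ b : ℝ, 0 < b ∧ ∃ k₀ : ℕ, ∀ k, k₀ ≤ k → b ≤ altSplit.β0 k := by
  rintro ⟨b, hb, k₀, h⟩
  have h1 := h (2 * k₀) (by omega)
  rw [altSplit_beta0_of_even (by omega)] at h1
  linarith

/-- (AF-1) for the alternating split with `C_r = 1`, on every box. [folklore] -/
theorem af1_alt (γ : ℝ) :
    ∀ k (p : Fin (k + 1) → ℝ), p ∈ B12Beta.HistBox γ k → |altSplit.β1 k p| ≤ 1 * p (Fin.last k) := by
  intro k p hp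
  have hpos := (hp (Fin.last k)).1
  show |(if k % 2 = 0 then p (Fin.last k) else 0)| ≤ _
  split_ifs
  · rw [abs_of_pos hpos]; linarith
  · simp [hpos.le]

/-- Hence `EverySlope` (the constant-road currency) for the alternating split, on every reference box. [folklore] -/
theorem everySlope_alt {γc : ℝ} (hγc : 0 < γc) : EverySlope altSplit γc :=
  everySlope_of_af1 altSplit hγc zero_le_one (af1_alt γc)

/-- (C) for the alternating family. [folklore] -/
theorem betaContH_alt (γ : ℝ) : BetaContH γ altBeta := fun k => by
  unfold altBeta
  split_ifs
  · exact (continuous_apply (Fin.last k)).continuousOn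
  · exact continuousOn_const

/-- The sign `0 ≤ β_{k+1}` on every box for the alternating family. [folklore] -/
theorem betaLowerH_alt (γ : ℝ) : BetaLowerH 0 γ altBeta := fun k p hp => by
  unfold altBeta
  split_ifs
  · exact (mem_box.mp hp (Fin.last k)).1.le
  · norm_num

/-- The printed upper bound `β_{k+1} ≤ 2` on `]0,1]`-boxes for the alternating family. [folklore] -/
theorem betaUpperH_alt : BetaUpperH 2 1 altBeta := fun k p hp => by
  unfold altBeta
  split_ifs
  · linarith [(mem_box.mp hp (Fin.last k)).2]
  · exact le_rfl

/-- (N2) for the alternating split, by parity bookkeeping: `n − 1 ≤ Σ_{j∈[k,k+n)} β⁰_{j+1}`, and `n ≤` it when the window ends before an even index.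
[folklore] -/
theorem windowSum_beta0_alt (k : ℕ) : ∀ n : ℕ,
    ((n : ℝ) - 1 ≤ ∑ j ∈ Finset.Ico k (k + n), altSplit.β0 j) ∧
      ((k + n) % 2 = 0 → (n : ℝ) ≤ ∑ j ∈ Finset.Ico k (k + n), altSplit.β0 j)
  | 0 => by simp
  | n + 1 => by
      obtain ⟨h1, h2⟩ := windowSum_beta0_alt k n
      rw [← add_assoc, Finset.sum_Ico_succ_top (Nat.le_add_right k n)]
      rcases Nat.mod_two_eq_zero_or_one (k + n) with he | ho
      · have hz : altSplit.β0 (k + n) = 0 := altSplit_beta0_of_even he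
        refine ⟨?_, fun h => absurd h (by omega)⟩
        rw [hz]
        push_cast
        linarith [h2 he]
      · have ht : altSplit.β0 (k + n) = 2 := altSplit_beta0_of_odd ho
        rw [ht]
        push_cast
        exact ⟨by linarith, fun _ => by linarith⟩

/-- **THE ALTERNATING FAMILY SATISFIES [I] THEOREM 2 AS PRINTED** for every forward-generated construction and every `L > 1` — although `β⁰_1 = 0`
and `β⁰_{k+1} = 0` at every even `k`.  Window floor `c = g/2`: a window of length `≥ 2` contains an odd scale (sum `≥ n − 1 ≥ n/2`); a window of
length `1` at an even scale `k` is the realised `g_k`, and `1/g_k² = 1/g² + g_k ≤ 2/g²` gives `g_k ≥ g/2`.  So neither the CAP sign list in strict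
form nor the tail's (eventual) floor is NECESSARY for (0.31): the printed constants may depend on `g`. [cite: Balaban1987RG1, Thm 2 (0.31) p.259] -/
theorem thm2Printed_alt {C : B12.Construction} (hgen : ForwardGenerated C altBeta) {L : ℝ} (hL : 1 < L) :
    B12.Thm2Printed C L := by
  refine thm2Printed_of_windowFloor hgen one_pos (by norm_num : (0 : ℝ) ≤ 2) (betaContH_alt 1) (betaLowerH_alt 1)
    betaUpperH_alt ?_ hL
  intro γ hγ hγ1 g hg hgγ
  refine ⟨g / 2, by positivity, by linarith, fun gs K hI hend hrg k hk => ?_⟩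
  have hge : ∀ j ∈ Finset.Ico k K, altSplit.β0 j ≤ altBeta j (prefixOf gs j) := by
    intro j hj
    have hjK : j ≤ K := (Finset.mem_Ico.mp hj).2.le
    rw [altSplit.split j]
    have h0 : 0 ≤ altSplit.β1 j (prefixOf gs j) := by
      show 0 ≤ (if j % 2 = 0 then prefixOf gs j (Fin.last j) else 0)
      split_ifs
      · simpa [prefixOf_apply, Fin.val_last] using (hI j hjK).1.le
      · exact le_rfl
    linarith
  rcases Nat.lt_or_ge (k + 1) K with h2 | h1
  · -- a window of length ≥ 2
    obtain ⟨hw, -⟩ := windowSum_beta0_alt k (K - k)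
    rw [Nat.add_sub_cancel' hk.le] at hw
    have hs := Finset.sum_le_sum hge
    have hcast : ((K - k : ℕ) : ℝ) = (K : ℝ) - k := Nat.cast_sub hk.le
    have hn : (2 : ℝ) ≤ (K : ℝ) - k := by
      rw [← hcast]; exact_mod_cast (by omega : 2 ≤ K - k)
    rw [hcast] at hw
    nlinarith [hw, hs, hn, mul_nonneg (sub_nonneg.mpr (hgγ.trans hγ1)) (by linarith : (0 : ℝ) ≤ (K : ℝ) - k)]
  · -- the window of length 1: `K = k + 1`
    have hK : K = k + 1 := by omega
    subst hK
    rw [Finset.sum_Ico_succ_top le_rfl, Finset.Ico_self, Finset.sum_empty, zero_add]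
    have e : (((k + 1 : ℕ) : ℝ) - k) = 1 := by push_cast; ring
    rw [e, mul_one]
    rcases Nat.mod_two_eq_zero_or_one k with he | ho
    · have hstep := hrg k (Nat.lt_succ_self k)
      have hval : altBeta k (prefixOf gs k) = gs k := by simp [altBeta, he, prefixOf_apply, Fin.val_last]
      rw [hval] at hstep ⊢
      rw [hend] at hstep
      have hgk := hI k (Nat.le_succ k)
      have hgk1 : gs k ≤ 1 := hgk.2.trans hγ1
      have hg1 : g ≤ 1 := hgγ.trans hγ1
      have h1g : 1 ≤ 1 / g ^ 2 := by
        rw [le_div_iff₀ (by positivity)]; nlinarith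
      have hinv : 1 / (gs k) ^ 2 ≤ 2 / g ^ 2 := by
        calc 1 / (gs k) ^ 2 = 1 / g ^ 2 + gs k := hstep
          _ ≤ 1 / g ^ 2 + 1 / g ^ 2 := by linarith
          _ = 2 / g ^ 2 := by ring
      have hgk2 : 0 < (gs k) ^ 2 := pow_pos hgk.1 2
      have hsq : (g / 2) ^ 2 ≤ (gs k) ^ 2 := by
        rw [div_le_div_iff₀ hgk2 (by positivity)] at hinv
        nlinarith
      exact (pow_le_pow_iff_left₀ (by positivity) hgk.1.le two_ne_zero).mp hsq
    · have hval : altBeta k (prefixOf gs k) = 2 := by simp [altBeta, ho]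
      rw [hval]
      linarith

/-- In particular the tree's canonical forward-computed construction of the alternating family satisfies Theorem 2 as printed for every `L > 1`.
[cite: Balaban1987RG1, Thm 2 (0.31) p.259] -/
theorem modelOf_alt_thm2Printed {L : ℝ} (hL : 1 < L) : B12.Thm2Printed (modelOf altBeta) L :=
  thm2Printed_alt (modelOf_forwardGenerated altBeta) hL

/-- **A FLOOR OF β⁰ IS NOT NECESSARY FOR (0.31)** (census form): there is a history family with a printed split having `β⁰_1 = 0`, NO eventual
positive floor of `β⁰`, (AF-1) ∕ `EverySlope` on every box, whose canonical construction satisfies [I] Theorem 2 as printed for every `L > 1`.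
So `CapTailSigns.thm2Printed_of_signs` ∕ `CapSignsConstRoad.thm2Printed_of_beta0Floor_everySlope` give SUFFICIENT, not necessary, currencies;
the necessary ones are (N1) and (N2) of `Gaps/CapSignsNecessary`. [folklore] -/
theorem floor_not_necessary :
    ∃ (β : HBeta) (S : B12Beta.OneLoopSplit β), S.β0 0 = 0 ∧
      (¬ ∃ b : ℝ, 0 < b ∧ ∃ k₀ : ℕ, ∀ k, k₀ ≤ k → b ≤ S.β0 k) ∧ (∀ γc : ℝ, 0 < γc → EverySlope S γc) ∧
      ∀ L : ℝ, 1 < L → B12.Thm2Printed (modelOf β) L :=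
  ⟨altBeta, altSplit, altSplit_beta0_zero, not_eventualFloor_alt, fun _ h => everySlope_alt h, fun _ hL => modelOf_alt_thm2Printed hL⟩

/-! ## §3 The boundary: same `β⁰_1 = 0`, remainder `−g_0` — Theorem 2 as printed FAILS -/

/-- The negative-boundary family: `β_1(g_0) = −g_0`, `β_{k+1} ≡ 1` for `k ≥ 1`. [folklore] -/
def negBeta : HBeta := fun k p => if k = 0 then -(p (Fin.last k)) else 1

/-- Its printed split: `β⁰_1 = 0`, `β⁰_{k+1} = 1` (`k ≥ 1`); `β¹_1(p) = −p_0`, `β¹_{k+1} = 0` (`k ≥ 1`). [folklore] -/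
def negSplit : B12Beta.OneLoopSplit negBeta where
  β0 k := if k = 0 then 0 else 1
  β1 k p := if k = 0 then -(p (Fin.last k)) else 0
  split k p := by unfold negBeta; split_ifs <;> simp
  vanish k p hp := by split_ifs <;> simp [hp]

/-- (N1) holds for the negative-boundary split (with `β⁰_1 = 0` exactly). [folklore] -/
theorem negSplit_beta0_nonneg (k : ℕ) : 0 ≤ negSplit.β0 k := by
  show 0 ≤ (if k = 0 then (0 : ℝ) else 1)
  split_ifs <;> norm_num

/-- `β⁰_1 = 0` for the negative-boundary split. [folklore] -/
theorem negSplit_beta0_zero : negSplit.β0 0 = 0 := by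
  show (if (0 : ℕ) = 0 then (0 : ℝ) else 1) = 0
  simp

/-- (N2) holds for the negative-boundary split: `n − 1 ≤ Σ_{j∈[k,k+n)} β⁰_{j+1}`. [folklore] -/
theorem windowSum_beta0_neg (k : ℕ) : ∀ n : ℕ, (n : ℝ) - 1 ≤ ∑ j ∈ Finset.Ico k (k + n), negSplit.β0 j
  | 0 => by simp
  | n + 1 => by
      have ih := windowSum_beta0_neg k n
      rw [← add_assoc, Finset.sum_Ico_succ_top (Nat.le_add_right k n)]
      by_cases hkn : k + n = 0
      · have hk : k = 0 := by omega
        have hn : n = 0 := by omega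
        subst hk; subst hn
        show ((0 + 1 : ℕ) : ℝ) - 1 ≤ ∑ j ∈ Finset.Ico 0 (0 + 0), negSplit.β0 j + (if 0 + 0 = 0 then (0 : ℝ) else 1)
        simp
      · have h1 : negSplit.β0 (k + n) = 1 := by
          show (if k + n = 0 then (0 : ℝ) else 1) = 1
          rw [if_neg hkn]
        rw [h1]
        push_cast
        linarith

/-- (AF-1) with `C_r = 1` for the negative-boundary split, on every box. [folklore] -/
theorem af1_neg (γ : ℝ) :
    ∀ k (p : Fin (k + 1) → ℝ), p ∈ B12Beta.HistBox γ k → |negSplit.β1 k p| ≤ 1 * p (Fin.last k) := by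
  intro k p hp
  have hpos := (hp (Fin.last k)).1
  show |(if k = 0 then -(p (Fin.last k)) else 0)| ≤ _
  split_ifs
  · rw [abs_neg, abs_of_pos hpos]; linarith
  · simp [hpos.le]

/-- Hence `EverySlope` for the negative-boundary split. [folklore] -/
theorem everySlope_neg {γc : ℝ} (hγc : 0 < γc) : EverySlope negSplit γc :=
  everySlope_of_af1 negSplit hγc zero_le_one (af1_neg γc)

/-- **AT THE BOUNDARY THE REMAINDER'S SIGN DECIDES**: the negative-boundary family meets (N1), (N2), (AF-1) ∕ `EverySlope`, has the same first
coefficient `β⁰_1 = 0` as the alternating family, yet NO forward-generated construction (halting outside, curried) satisfies [I] Theorem 2 as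
printed for any `L > 1`: on the lattice `K = 1`, `β_1(g_0) = −g_0 < 0 < β log L` (`Beta.PrefixAbsorption.first_beta_pos_of_thm2Printed`). [cite: Balaban1987RG1, Thm 2 (0.31) p.259] -/
theorem not_thm2Printed_neg {C : B12.Construction} (hgen : ForwardGenerated C negBeta) (hhalt : HaltsOutside C negBeta)
    (hcur : CurriesHBeta C negBeta) {L : ℝ} (hL : 1 < L) : ¬ B12.Thm2Printed C L := by
  intro h
  obtain ⟨g0, hg0, hpos⟩ := first_beta_pos_of_thm2Printed hgen hhalt hcur hL h 0
  have hval : negBeta 0 (prefixOf (C ⟨1, 0, g0⟩).flow.g 0) = -((C ⟨1, 0, g0⟩).flow.g 0) := by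
    simp [negBeta, prefixOf_apply]
  have hg : (C ⟨1, 0, g0⟩).flow.g 0 = g0 := hgen.1 ⟨1, 0, g0⟩
  rw [hval, hg] at hpos
  linarith

/-- In particular the canonical construction `FlowStepRuns.modelOf negBeta` violates Theorem 2 as printed for every `L > 1`. [folklore] -/
theorem modelOf_neg_not_thm2Printed {L : ℝ} (hL : 1 < L) : ¬ B12.Thm2Printed (modelOf negBeta) L :=
  not_thm2Printed_neg (modelOf_forwardGenerated _) (modelOf_haltsOutside _) (modelOf_curries _) hL

/-- **THE BOUNDARY, census form**: two splits with `β⁰_1 = 0`, both meeting (N1), (N2) (`n − 1 ≤` every window sum of length `n`) and `EverySlope`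
on every box; the canonical construction of the first satisfies [I] Theorem 2 as printed for every `L > 1`, that of the second for none.  So the
necessary list (N1) cannot be sharpened to strict signs, and a certified `β⁰_{k+1} = 0` exactly would leave (0.31) to the remainder.
[folklore] -/
theorem boundary_decided_by_remainder :
    ∃ (β₁ β₂ : HBeta) (S₁ : B12Beta.OneLoopSplit β₁) (S₂ : B12Beta.OneLoopSplit β₂),
      S₁.β0 0 = 0 ∧ S₂.β0 0 = 0 ∧ (∀ k, 0 ≤ S₁.β0 k) ∧ (∀ k, 0 ≤ S₂.β0 k) ∧
      (∀ k n : ℕ, (n : ℝ) - 1 ≤ ∑ j ∈ Finset.Ico k (k + n), S₁.β0 j) ∧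
      (∀ k n : ℕ, (n : ℝ) - 1 ≤ ∑ j ∈ Finset.Ico k (k + n), S₂.β0 j) ∧
      (∀ γc : ℝ, 0 < γc → EverySlope S₁ γc ∧ EverySlope S₂ γc) ∧
      (∀ L : ℝ, 1 < L → B12.Thm2Printed (modelOf β₁) L) ∧ (∀ L : ℝ, 1 < L → ¬ B12.Thm2Printed (modelOf β₂) L) :=
  ⟨altBeta, negBeta, altSplit, negSplit, altSplit_beta0_zero, negSplit_beta0_zero, altSplit_beta0_nonneg, negSplit_beta0_nonneg,
    fun k n => (windowSum_beta0_alt k n).1, windowSum_beta0_neg,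
    fun _ h => ⟨everySlope_alt h, everySlope_neg h⟩, fun _ hL => modelOf_alt_thm2Printed hL, fun _ hL => modelOf_neg_not_thm2Printed hL⟩

/-! ## §4 The near-zero control in (N1)∕(N2) is load-bearing: the FACE family (fixed remainder constant, ALL β⁰ negative, (0.31) holds) -/

/-- The FACE family: `β_{k+1}(p) = 1` off the face `g_k = 0`, `= −1` ON the face (discontinuous there). [folklore] -/
def faceBeta : HBeta := fun k p => if p (Fin.last k) = 0 then -1 else 1

/-- Its printed split (forced — the split is unique, `Summit.QuantumFields.BalabanUV.Beta.RemainderExplicitSplitUnique.β0_eq_apply`: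
`β⁰_{k+1} = β_{k+1}|_{g_k = 0}`): `β⁰ ≡ −1`, `β¹ = 0` on the face, `= 2` off it — bounded by the FIXED constant `2`, NOT small near zero. [folklore] -/
def faceSplit : B12Beta.OneLoopSplit faceBeta where
  β0 _ := -1
  β1 k p := if p (Fin.last k) = 0 then 0 else 2
  split k p := by unfold faceBeta; split_ifs <;> norm_num
  vanish k p hp := by simp [hp]

/-- Off the face (on every box `]0,γ]^{k+1}`) the FACE family is the constant `1`. [folklore] -/
theorem faceBeta_eq_one {γ : ℝ} {k : ℕ} {p : Fin (k + 1) → ℝ} (hp : p ∈ Box γ k) : faceBeta k p = 1 := by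
  have h := (mem_box.mp hp (Fin.last k)).1
  simp [faceBeta, h.ne']

/-- ALL one-loop coefficients of the FACE split are NEGATIVE. [folklore] -/
theorem faceSplit_beta0_neg (k : ℕ) : faceSplit.β0 k < 0 := by
  show (-1 : ℝ) < 0
  norm_num

/-- The FACE split has the constant-form remainder bound `RemainderConst faceSplit γ 2` on EVERY box (a fixed constant — the (D4) shape for ONE
construction — but not the every-slope currency). [folklore] -/
theorem remainderConst_face (γ : ℝ) : RemainderConst faceSplit γ 2 := fun k p hp => by
  have h := (hp (Fin.last k)).1
  show |(if p (Fin.last k) = 0 then (0 : ℝ) else 2)| ≤ 2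
  simp [h.ne']

/-- **THE FACE FAMILY SATISFIES [I] THEOREM 2 AS PRINTED** (every forward-generated construction, every `L > 1`): on the boxes `β ≡ 1`
(`FlowStepRuns.thm2Printed_of_boxBoundsH` with `b = β′ = 1`). [cite: Balaban1987RG1, Thm 2 (0.31) p.259] -/
theorem thm2Printed_face {C : B12.Construction} (hgen : ForwardGenerated C faceBeta) {L : ℝ} (hL : 1 < L) :
    B12.Thm2Printed C L :=
  thm2Printed_of_boxBoundsH hgen hL one_pos one_pos le_rfl (γ₀ := 1)
    (fun _ => continuousOn_const.congr fun _ hp => faceBeta_eq_one hp)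
    (fun _ _ hp => (faceBeta_eq_one hp).symm.le) (fun _ _ hp => (faceBeta_eq_one hp).le)

/-- **THE NEAR-ZERO CONTROL IN (N1) IS LOAD-BEARING** (census form): a split with EVERY one-loop coefficient NEGATIVE (`β⁰ ≡ −1`) and a FIXED
remainder constant (`|β¹| ≤ 2` on every box) whose canonical construction satisfies Theorem 2 as printed for every `L > 1`.  So
`CapSignsNecessary.beta0_nonneg_of_thm2Printed` genuinely needs its hypothesis (remainder small at the zero history scale-wise: continuity of β¹
up to the face `g_k = 0` — the [I] p. 264 «defined on [0, γ]» reading —, (AF-1), or the every-slope currency); with ONE fixed remainder constant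
(the (D4) shape `RemainderConst S γ r` alone) a certified negative `β⁰_{k+1}` would NOT refute (0.31).  Reason: the printed split fixes
`β⁰_{k+1} = β_{k+1}|_{g_k = 0}`, which constrains (0.31) — a statement about `β` on the OPEN boxes — only through continuity at the face. [folklore] -/
theorem nearZero_control_needed :
    ∃ (β : HBeta) (S : B12Beta.OneLoopSplit β), (∀ k, S.β0 k < 0) ∧ (∀ γ : ℝ, RemainderConst S γ 2) ∧
      ∀ L : ℝ, 1 < L → B12.Thm2Printed (modelOf β) L :=
  ⟨faceBeta, faceSplit, faceSplit_beta0_neg, remainderConst_face, fun _ hL => thm2Printed_face (modelOf_forwardGenerated _) hL⟩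

end

end Summit.QuantumFields.BalabanUV.Gaps.CapFloorNotNecessary
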